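import Summits.CriticalPhenomena.Ising3DConformalLimit.Theses.ArmHyperscaling
import Literature.Probability.LatticeModels.OnsagerYang
import HarnessLib

/-!
# `ForgettingGivesOneArm` (item stmt-CriticalPhenomena-15595, route ArmHyperscaling, support)

Two-point `+`-boundary forgetting at one macroscopic ratio implies the one-arm bound
`OneArmHyperscaling` (item stmt-CriticalPhenomena-15591): if for some `K ≥ 3` and `C`,
`⟨σ₀σ_{2ne₁}⟩⁺_{Λ_{Kn};β_c} ≤ C·⟨σ₀σ_{2ne₁}⟩⁺_{β_c}` for all `n ≥ 1`, then
`(⟨σ₀⟩⁺_{Λ_{(K+2)n};β_c})² ≤ C·⟨σ₀σ_{2ne₁}⟩⁺_{β_c}` for all `n ≥ 1`.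

Proof (as in the route text, 3 lines): GKS II in the plus box `Λ = Λ_{Kn}` gives
`⟨σ₀σ_z⟩⁺_Λ ≥ ⟨σ₀⟩⁺_Λ ⟨σ_z⟩⁺_Λ` (`z = 2ne₁`); plus correlations are antitone in the volume
(`isingCorr_plus_le_of_subset`) and `Λ_{Kn} ⊆ Λ_{(K+2)n}`, `Λ_{Kn} ⊆ z + Λ_{(K+2)n}`, so both
one-point factors are `≥ m⁺_{(K+2)n}` (translation covariance of finite-volume plus states,
`isingCorr_plus_map_shift`); hence `(m⁺_{(K+2)n})² ≤ ⟨σ₀σ_z⟩⁺_Λ ≤ C·⟨σ₀σ_z⟩⁺_{β_c}`.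

This is the GKS edge from route BallOrbitComparison's `UniformBoundaryForgetting` at order 2 to the
one-arm crux; composed with the landed `nearCriticalLeeYangGap_of_oneArmHyperscaling` (p399405) and
`hasNonGaussianCriticalSmearing_three_of_oneArmHyperscaling` (p400339) it makes
"order-2 boundary forgetting ⟹ block-spin non-Gaussianity on `ℤ³`" a tree theorem.

References: R. B. Griffiths, J. Math. Phys. 8 (1967) 478, 484; D. G. Kelly, S. Sherman, J. Math.
Phys. 9 (1968) 466; S. Friedli, Y. Velenik, *Statistical Mechanics of Lattice Systems* (CUP 2017),
Thm. 3.20, Exercise 3.12, proof of Thm. 3.17.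
-/

noncomputable section

namespace Summit.CriticalPhenomena.Ising3DConformalLimit.ArmHyperscalingForgetting

open Literature.Probability.LatticeModels Finset
open scoped symmDiff

/-- The axis point `2n e₁ ∈ ℤ³` lies in the box `Λ_{Kn}` when `3 ≤ K`. [folklore] -/
theorem axisPoint_mem_box {K n : ℕ} (hK : 3 ≤ K) :
    (Pi.single 0 (2 * (n : ℤ)) : Site 3) ∈ box 3 (K * n) := by
  rw [mem_box]
  intro i
  have hKn : (2 : ℤ) * n ≤ ((K * n : ℕ) : ℤ) := by push_cast; nlinarith
  by_cases hi : i = 0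
  · subst hi
    simp only [Pi.single_eq_same]
    constructor <;> omega
  · simp only [Pi.single_apply, hi, if_false]
    constructor <;> omega

/-- `Λ_{Kn} ⊆ 2n e₁ + Λ_{(K+2)n}`: the box of radius `Kn` lies in the translate by the axis point
`2n e₁` of the box of radius `(K+2)n`. [folklore] -/
theorem box_subset_shift_box (K n : ℕ) :
    box 3 (K * n) ⊆ (box 3 ((K + 2) * n)).map
      (Site.shift (Pi.single 0 (2 * (n : ℤ)) : Site 3)).toEmbedding := by
  intro y hy
  rw [mem_map_shift_iff', mem_box]
  rw [mem_box] at hy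
  intro i
  have hyi := hy i
  have hcast : (((K + 2) * n : ℕ) : ℤ) = ((K * n : ℕ) : ℤ) + 2 * n := by push_cast; ring
  by_cases hi : i = 0
  · subst hi
    simp only [Pi.sub_apply, Pi.single_eq_same]
    constructor <;> omega
  · simp only [Pi.sub_apply, Pi.single_apply, hi, if_false, sub_zero]
    constructor <;> omega

/-- **Translation step**: the plus magnetisation at the centre `z` of the translated box `z + Λ_L`
equals the plus magnetisation at the centre of `Λ_L` (Friedli–Velenik 2017, proof of Thm. 3.17,
translation covariance of finite-volume plus states). [cite: FriedliVelenik2017, Thm. 3.17 (proof), p. 113] -/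
theorem isingCorr_plus_shift_box_center (L : ℕ) (z : Site 3) (β h : ℝ) :
    isingCorr (zdGraph 3) ((box 3 L).map (Site.shift z).toEmbedding) β h .plus ({z} : Finset (Site 3)) =
      isingCorr (zdGraph 3) (box 3 L) β h .plus ({0} : Finset (Site 3)) := by
  have hmap := isingCorr_plus_map_shift z (box 3 L) ({0} : Finset (Site 3)) β h
  rw [Finset.map_singleton] at hmap
  have hz : (Site.shift z).toEmbedding (0 : Site 3) = z := by simp
  rwa [hz] at hmap

/-- **One-point forgetting from GKS** (the core inequality): for `K ≥ 3` and `n ≥ 1`,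
`(m⁺_{(K+2)n})² ≤ ⟨σ₀σ_{2ne₁}⟩⁺_{Λ_{Kn};β_c,0}` on `ℤ³` — GKS II in the plus box `Λ_{Kn}`,
antitonicity of plus correlations in the volume, and translation covariance
(Friedli–Velenik 2017, Thm. 3.20 (3.22), Exercise 3.12, proof of Thm. 3.17). [cite: FriedliVelenik2017, Thm. 3.20, eq. (3.22), p. 109] -/
theorem boxMag_sq_le_plusBoxPair {K n : ℕ} (hK : 3 ≤ K) (hn : 1 ≤ n) :
    isingCorr (zdGraph 3) (box 3 ((K + 2) * n)) (criticalBeta 3) 0 .plus ({0} : Finset (Site 3)) ^ 2 ≤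
      isingCorr (zdGraph 3) (box 3 (K * n)) (criticalBeta 3) 0 .plus
        ({0, Pi.single 0 (2 * (n : ℤ))} : Finset (Site 3)) := by
  set z : Site 3 := Pi.single 0 (2 * (n : ℤ)) with hz
  have hβ : 0 ≤ criticalBeta 3 := criticalBeta_nonneg 3
  have h0Λ : (0 : Site 3) ∈ box 3 (K * n) := zero_mem_box 3 _
  have hzΛ : z ∈ box 3 (K * n) := axisPoint_mem_box hK
  have h0sub : ({0} : Finset (Site 3)) ⊆ box 3 (K * n) := Finset.singleton_subset_iff.2 h0Λ
  have hzsub : ({z} : Finset (Site 3)) ⊆ box 3 (K * n) := Finset.singleton_subset_iff.2 hzΛ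
  -- the centre magnetisation of the bigger box, and its nonnegativity (GKS I)
  have hm0 : 0 ≤ isingCorr (zdGraph 3) (box 3 ((K + 2) * n)) (criticalBeta 3) 0 .plus
      ({0} : Finset (Site 3)) :=
    GKSInequalities.gks_one_holds (zdGraph 3) hβ le_rfl (Or.inr rfl)
      (Finset.singleton_subset_iff.2 (zero_mem_box 3 _))
  -- (1) volume antitonicity at the origin: `m⁺_{(K+2)n} ≤ ⟨σ₀⟩⁺_{Λ_{Kn}}`
  have h1 : isingCorr (zdGraph 3) (box 3 ((K + 2) * n)) (criticalBeta 3) 0 .plus ({0} : Finset (Site 3)) ≤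
      isingCorr (zdGraph 3) (box 3 (K * n)) (criticalBeta 3) 0 .plus ({0} : Finset (Site 3)) :=
    isingCorr_plus_le_of_subset (zdGraph 3) hβ le_rfl h0sub
      (box_mono 3 (Nat.mul_le_mul_right n (Nat.le_add_right K 2)))
  -- (2) volume antitonicity at `z` for the translated box, then translation covariance
  have h2 : isingCorr (zdGraph 3) (box 3 ((K + 2) * n)) (criticalBeta 3) 0 .plus ({0} : Finset (Site 3)) ≤
      isingCorr (zdGraph 3) (box 3 (K * n)) (criticalBeta 3) 0 .plus ({z} : Finset (Site 3)) := by
    have h := isingCorr_plus_le_of_subset (zdGraph 3) hβ le_rfl hzsub (box_subset_shift_box K n)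
    rwa [isingCorr_plus_shift_box_center] at h
  -- (3) GKS II in the plus box `Λ_{Kn}`
  have hgks : isingCorr (zdGraph 3) (box 3 (K * n)) (criticalBeta 3) 0 .plus ({0} : Finset (Site 3)) *
      isingCorr (zdGraph 3) (box 3 (K * n)) (criticalBeta 3) 0 .plus ({z} : Finset (Site 3)) ≤
      isingCorr (zdGraph 3) (box 3 (K * n)) (criticalBeta 3) 0 .plus (({0} : Finset (Site 3)) ∆ {z}) :=
    GKSInequalities.gks_two_holds (zdGraph 3) hβ le_rfl (Or.inr rfl) h0sub hzsub
  -- `z ≠ 0`, so `{0} ∆ {z} = {0, z}`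
  have hz0 : z ≠ 0 := by
    intro h
    have h' := congr_fun h 0
    simp only [hz, Pi.single_eq_same, Pi.zero_apply] at h'
    omega
  have hsd : (({0} : Finset (Site 3)) ∆ {z}) = ({0, z} : Finset (Site 3)) := by
    ext y
    simp only [Finset.mem_symmDiff, Finset.mem_insert, Finset.mem_singleton]
    constructor
    · rintro (⟨h, -⟩ | ⟨h, -⟩)
      · exact Or.inl h
      · exact Or.inr h
    · rintro (h | h)
      · exact Or.inl ⟨h, fun h' => hz0 (h'.symm.trans h)⟩
      · exact Or.inr ⟨h, fun h' => hz0 (h.symm.trans h')⟩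
  rw [hsd] at hgks
  calc isingCorr (zdGraph 3) (box 3 ((K + 2) * n)) (criticalBeta 3) 0 .plus ({0} : Finset (Site 3)) ^ 2
      = isingCorr (zdGraph 3) (box 3 ((K + 2) * n)) (criticalBeta 3) 0 .plus ({0} : Finset (Site 3)) *
          isingCorr (zdGraph 3) (box 3 ((K + 2) * n)) (criticalBeta 3) 0 .plus ({0} : Finset (Site 3)) :=
        sq _
    _ ≤ isingCorr (zdGraph 3) (box 3 (K * n)) (criticalBeta 3) 0 .plus ({0} : Finset (Site 3)) *
          isingCorr (zdGraph 3) (box 3 (K * n)) (criticalBeta 3) 0 .plus ({z} : Finset (Site 3)) :=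
        mul_le_mul h1 h2 hm0 (hm0.trans h1)
    _ ≤ _ := hgks

/-- **Item stmt-CriticalPhenomena-15595 `ForgettingGivesOneArm`** (route ArmHyperscaling, support;
the BallOrbitComparison edge): two-point `+`-boundary forgetting at one macroscopic ratio `K ≥ 3`,
`⟨σ₀σ_{2ne₁}⟩⁺_{Λ_{Kn};β_c} ≤ C⟨σ₀σ_{2ne₁}⟩⁺_{β_c}` for all `n ≥ 1`, implies `OneArmHyperscaling` with
ratio `K + 2` and the same constant: GKS II in the plus box, antitonicity of plus correlations in the
volume, translation covariance (Friedli–Velenik 2017, Thm. 3.20, Exercise 3.12, Thm. 3.17). [cite: FriedliVelenik2017, Thm. 3.20, eq. (3.22), p. 109] -/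
theorem forgettingGivesOneArm_proof :
    Summit.CriticalPhenomena.Ising3DConformalLimit.Theses.ArmHyperscaling.ForgettingGivesOneArm := by
  unfold Summit.CriticalPhenomena.Ising3DConformalLimit.Theses.ArmHyperscaling.ForgettingGivesOneArm
    Summit.CriticalPhenomena.Ising3DConformalLimit.Theses.ArmHyperscaling.OneArmHyperscaling
  rintro ⟨K, hK, C, hC⟩
  refine ⟨K + 2, by omega, C, fun n hn => ?_⟩
  exact (boxMag_sq_le_plusBoxPair hK hn).trans (hC n hn)

end Summit.CriticalPhenomena.Ising3DConformalLimit.ArmHyperscalingForgetting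

end
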